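import Summits.HubbardSuperconductivity.HubbardSuperconductivity.Theorems.SoloBlindMottCounting
import HarnessLib

/-!
# The Mott floor (Theorem 34, part 2/3)

Solo-blind programme `HubbardSuperconductivity`, generation 29.

**Theorem (`mott_floor`).** On the `L × L` torus with `t = 1` and `U ≥ 16`, every `N`-particle
vector satisfies `re ⟨ψ, H_U ψ⟩ ≥ -(4 (L² - N) + 64 L²/U) ‖ψ‖²`; hence
(`mott_floor_minEnergyOn`) the same bound for the lowest energy of every sector `(N, S_z = M)`.

*Proof.* Each bond term `⟨ψ, c†_{xσ} c_{yσ} ψ⟩` is a sum over pairs of configurations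
`(u ∪ (x,σ), u ∪ (y,σ))`; the weighted AM–GM inequality charges `½|ψ|²` to each side when the hop
moves a hole or a doublon, and `α|ψ|²` to the side carrying the extra doublon, `β|ψ|²` to the
other side (`4αβ = 1`) when it creates or destroys one (`norm_bond_le`).  Counting, per
configuration `s`, how many bonds charge it (`sum_V_le`, `sum_adj_V_le`: a hole or a doublon has
`≤ 4` neighbours and the spin of the moving electron is determined) gives
`re ⟨ψ, T ψ⟩ ≤ Σ_s |ψ(s)|² (4 E(s) + (4 + 16α) D(s) + 8β L²)` with `E` = holes, `D` = doublons
(`re_hopping_le`).  With `E = L² - N + D`, `α = U/32`, `β = 8/U` the doublon terms are absorbed by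
`+U D` as soon as `U ≥ 16`, leaving `-(4 (L² - N) + 64 L²/U)`.

Reading: below half filling only the `L² - N` holes move freely (`-4` each, `4` neighbours); every
other hop creates a double occupancy and costs `U`, whence the `t²/U`-type remainder `64 L²/U`.
At density `1 - δ` the floor is `-(4δ + 64/U) L²`, against the free-fermion scale `-Θ(L²)`:
this is the only place in the crutch analysis where the repulsion `U` HELPS (it suppresses the
competitors' kinetic energy), and it yields the `δ`-uniform crutch threshold of part 3/3.
[this work]
-/

noncomputable section

namespace Summit.HubbardSuperconductivity.HubbardSuperconductivity.Theorems.MottFloor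

open Matrix Finset Literature.Probability.LatticeModels Literature.MathematicalPhysics.QuantumLattice
  Literature.MathematicalPhysics.QuantumLattice.EigenvalueContinuation
open scoped ComplexOrder ComplexConjugate

variable {L : ℕ} [NeZero L]

/-- Pin `DecidableEq` on orbitals to the order-derived instance used by the orbital-generic
fermion lemmas (avoids instance-unification blow-ups in `if _ ∈ _` terms). [folklore] -/
local instance (priority := high) instDecidableEqOrbTorusMott₂ :
    DecidableEq (Orb (FermionTorus 2 L)) := LinearOrder.toDecidableEq

/-- Pin `DecidableEq` on sites likewise. [folklore] -/
local instance (priority := high) instDecidableEqTorusMott₂ :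
    DecidableEq (FermionTorus 2 L) := LinearOrder.toDecidableEq

/-! ### The bond term against the configuration weights -/

/-- The weight `V_s(x,y,σ)` that configuration `s` receives from the bond term `c†_{xσ} c_{yσ}`
after the type-dependent AM–GM split: `cA` on the side where `(x,σ)` is occupied, `cB` on the
side where `(y,σ)` is occupied, the type being read off from the opposite-spin orbitals. -/
def V (α β : ℝ) (s : Finset (Orb (FermionTorus 2 L))) (x y : FermionTorus 2 L) (σ : Fin 2) : ℝ :=
  (if orb x σ ∈ s ∧ orb y σ ∉ s then
      cA α β (decide (orb x (1 - σ) ∈ s)) (decide (orb y (1 - σ) ∈ s)) else 0) +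
    (if orb y σ ∈ s ∧ orb x σ ∉ s then
      cB α β (decide (orb x (1 - σ) ∈ s)) (decide (orb y (1 - σ) ∈ s)) else 0)

omit [NeZero L] in
/-- **Bond estimate**: `|⟨ψ, c†_{xσ} c_{yσ} ψ⟩| ≤ Σ_s |ψ(s)|² V_s(x,y,σ)` for `x ≠ y`. [this work] -/
theorem norm_bond_le {α β : ℝ} (hα : 0 < α) (hαβ : 4 * α * β = 1)
    (ψ : Fock (Orb (FermionTorus 2 L))) {x y : FermionTorus 2 L} (hxy : x ≠ y) (σ : Fin 2) :
    ‖star ψ ⬝ᵥ ((creation (orb x σ) * annihilation (orb y σ)) *ᵥ ψ)‖ ≤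
      ∑ s, ‖ψ s‖ ^ 2 * V α β s x y σ := by
  have hσ : (1 - σ) ≠ σ := by fin_cases σ <;> decide
  have hab : orb x σ ≠ orb y σ := fun h => hxy (orb_inj.1 h).1
  have ha'a : orb x (1 - σ) ≠ orb x σ := fun h => hσ (orb_inj.1 h).2
  have hb'a : orb y (1 - σ) ≠ orb x σ := fun h => hxy (orb_inj.1 h).1.symm
  have ha'b : orb x (1 - σ) ≠ orb y σ := fun h => hxy (orb_inj.1 h).1
  have hb'b : orb y (1 - σ) ≠ orb y σ := fun h => hσ (orb_inj.1 h).2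
  refine (norm_hop_le (orb x σ) (orb y σ) ψ).trans ?_
  -- termwise weighted AM–GM
  have step1 : ∀ u : Finset (Orb (FermionTorus 2 L)),
      (if orb x σ ∉ u ∧ orb y σ ∉ u then ‖ψ (insert (orb x σ) u)‖ * ‖ψ (insert (orb y σ) u)‖
        else 0) ≤
      (if orb x σ ∉ u ∧ orb y σ ∉ u then
          cA α β (decide (orb x (1 - σ) ∈ insert (orb x σ) u))
              (decide (orb y (1 - σ) ∈ insert (orb x σ) u)) *
            ‖ψ (insert (orb x σ) u)‖ ^ 2 else 0) +
        (if orb y σ ∉ u ∧ orb x σ ∉ u then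
          cB α β (decide (orb x (1 - σ) ∈ insert (orb y σ) u))
              (decide (orb y (1 - σ) ∈ insert (orb y σ) u)) *
            ‖ψ (insert (orb y σ) u)‖ ^ 2 else 0) := by
    intro u
    by_cases h : orb x σ ∉ u ∧ orb y σ ∉ u
    · rw [if_pos h, if_pos h, if_pos h.symm]
      have e1 : decide (orb x (1 - σ) ∈ insert (orb x σ) u) = decide (orb x (1 - σ) ∈ u) := by
        simp [Finset.mem_insert, ha'a]
      have e2 : decide (orb y (1 - σ) ∈ insert (orb x σ) u) = decide (orb y (1 - σ) ∈ u) := by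
        simp [Finset.mem_insert, hb'a]
      have e3 : decide (orb x (1 - σ) ∈ insert (orb y σ) u) = decide (orb x (1 - σ) ∈ u) := by
        simp [Finset.mem_insert, ha'b]
      have e4 : decide (orb y (1 - σ) ∈ insert (orb y σ) u) = decide (orb y (1 - σ) ∈ u) := by
        simp [Finset.mem_insert, hb'b]
      rw [e1, e2, e3, e4]
      exact mul_le_cA_cB hα hαβ _ _ _ _
    · rw [if_neg h, if_neg h, if_neg (fun h' => h h'.symm), add_zero]
  refine (Finset.sum_le_sum fun u _ => step1 u).trans (le_of_eq ?_)
  have hA := sum_ite_insert (orb x σ) (fun u => orb y σ ∉ u)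
    (fun s => cA α β (decide (orb x (1 - σ) ∈ s)) (decide (orb y (1 - σ) ∈ s)) * ‖ψ s‖ ^ 2)
  have hB := sum_ite_insert (orb y σ) (fun u => orb x σ ∉ u)
    (fun s => cB α β (decide (orb x (1 - σ) ∈ s)) (decide (orb y (1 - σ) ∈ s)) * ‖ψ s‖ ^ 2)
  rw [Finset.sum_add_distrib, hA, hB, ← Finset.sum_add_distrib]
  refine Finset.sum_congr rfl fun s _ => ?_
  simp only [Finset.mem_erase, ne_eq, hab, hab.symm, not_false_eq_true, true_and, V]
  split_ifs <;> ring

omit [NeZero L] in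
/-- **Summing the two spins**: `Σ_σ V_s(x,y,σ) ≤ P_s(x) + P_s(y) + 2β` with
`P_s(z) = ½ [z empty] + (½ + 2α) [z doubly occupied]`. [this work] -/
theorem sum_V_le {α β : ℝ} (hα : 0 ≤ α) (hβ : 0 ≤ β) (s : Finset (Orb (FermionTorus 2 L)))
    (x y : FermionTorus 2 L) :
    ∑ σ, V α β s x y σ ≤
      ((if IsEmp s x then 1 / 2 else 0) + (if IsDbl s x then 1 / 2 + 2 * α else 0)) +
        ((if IsEmp s y then 1 / 2 else 0) + (if IsDbl s y then 1 / 2 + 2 * α else 0)) +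
        2 * β := by
  rw [Fin.sum_univ_two]
  simp only [V, Fin.isValue, sub_zero, sub_self, IsEmp, IsDbl]
  by_cases h1 : orb x 0 ∈ s <;> by_cases h2 : orb x 1 ∈ s <;> by_cases h3 : orb y 0 ∈ s <;>
    by_cases h4 : orb y 1 ∈ s <;> simp [h1, h2, h3, h4, cA, cB] <;> linarith

omit [NeZero L] in
/-- `|Λ| = L²` for the fermionic square torus (file-local copy of a folklore fact). -/
private theorem card_fermionTorus' : Fintype.card (FermionTorus 2 L) = L ^ 2 := by
  simp [FermionTorus, Fintype.card_lex]

/-- The bound `Γ_s ≤ 4 E(s) + (4 + 16α) D(s) + 8β L²` on the total weight received by a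
configuration from all bonds. [this work] -/
theorem sum_adj_V_le {α β : ℝ} (hα : 0 ≤ α) (hβ : 0 ≤ β) (s : Finset (Orb (FermionTorus 2 L))) :
    ∑ x, ∑ y, (if (fermionTorusGraph 2 L).Adj x y then ∑ σ, V α β s x y σ else 0) ≤
      4 * (holeCount s : ℝ) + (4 + 16 * α) * (doublonCount s : ℝ) + 8 * β * (L : ℝ) ^ 2 := by
  set P : FermionTorus 2 L → ℝ := fun z =>
    (if IsEmp s z then 1 / 2 else 0) + (if IsDbl s z then 1 / 2 + 2 * α else 0) with hP
  have hP0 : ∀ z, 0 ≤ P z := by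
    intro z; simp only [hP]; split_ifs <;> linarith
  have h1 : ∑ x, ∑ y, (if (fermionTorusGraph 2 L).Adj x y then ∑ σ, V α β s x y σ else 0) ≤
      ∑ x, ∑ y, (if (fermionTorusGraph 2 L).Adj x y then P x else 0) +
        ∑ x, ∑ y, (if (fermionTorusGraph 2 L).Adj x y then P y else 0) +
        ∑ x, ∑ y, (if (fermionTorusGraph 2 L).Adj x y then 2 * β else 0) := by
    rw [← Finset.sum_add_distrib, ← Finset.sum_add_distrib]
    refine Finset.sum_le_sum fun x _ => ?_
    rw [← Finset.sum_add_distrib, ← Finset.sum_add_distrib]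
    refine Finset.sum_le_sum fun y _ => ?_
    split_ifs
    · exact sum_V_le hα hβ s x y
    · simp
  have hE : ∑ z, P z = 1 / 2 * (holeCount s : ℝ) + (1 / 2 + 2 * α) * (doublonCount s : ℝ) := by
    simp only [hP, Finset.sum_add_distrib, holeCount, doublonCount_eq_card_isDbl]
    rw [← Finset.sum_filter, ← Finset.sum_filter, Finset.sum_const, Finset.sum_const, nsmul_eq_mul,
      nsmul_eq_mul]
    ring
  have hβsum : ∑ x : FermionTorus 2 L, ∑ y, (if (fermionTorusGraph 2 L).Adj x y then 2 * β else 0)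
      ≤ 8 * β * (L : ℝ) ^ 2 := by
    refine (sum_adj_left_le (fun _ => 2 * β) fun _ => by positivity).trans (le_of_eq ?_)
    rw [Finset.sum_const, Finset.card_univ, card_fermionTorus', nsmul_eq_mul]
    push_cast; ring
  have hl := sum_adj_left_le P hP0
  have hr := sum_adj_right_le P hP0
  rw [hE] at hl hr
  linarith

/-! ### The Mott floor -/

/-- **The hopping energy against holes and doublons**: for `α > 0`, `4αβ = 1`,
`re ⟨ψ, Σ_{x∼y,σ} c†_{xσ} c_{yσ} ψ⟩ ≤ Σ_s |ψ(s)|² (4 E(s) + (4 + 16α) D(s) + 8β L²)`. [this work] -/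
theorem re_hopping_le {α β : ℝ} (hα : 0 < α) (hαβ : 4 * α * β = 1)
    (ψ : Fock (Orb (FermionTorus 2 L))) :
    (star ψ ⬝ᵥ (∑ x : FermionTorus 2 L, ∑ y, ∑ σ : Fin 2,
        if (fermionTorusGraph 2 L).Adj x y then creation (orb x σ) * annihilation (orb y σ) else 0)
        *ᵥ ψ).re ≤
      ∑ s, ‖ψ s‖ ^ 2 * (4 * (holeCount s : ℝ) + (4 + 16 * α) * (doublonCount s : ℝ) +
        8 * β * (L : ℝ) ^ 2) := by
  have hβ : 0 ≤ β := by
    have : 0 < 4 * α * β := by rw [hαβ]; exact one_pos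
    nlinarith
  -- expand the expectation bond by bond
  have hexp : (star ψ ⬝ᵥ (∑ x : FermionTorus 2 L, ∑ y, ∑ σ : Fin 2,
        if (fermionTorusGraph 2 L).Adj x y then creation (orb x σ) * annihilation (orb y σ) else 0)
        *ᵥ ψ).re =
      ∑ x : FermionTorus 2 L, ∑ y, ∑ σ : Fin 2,
        (if (fermionTorusGraph 2 L).Adj x y then
          star ψ ⬝ᵥ ((creation (orb x σ) * annihilation (orb y σ)) *ᵥ ψ) else 0).re := by
    simp only [Matrix.sum_mulVec, dotProduct_sum, Complex.re_sum, dotProduct_ite_mulVec]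
  rw [hexp]
  -- bound each bond term
  have hbond : ∀ x y : FermionTorus 2 L, ∀ σ : Fin 2,
      (if (fermionTorusGraph 2 L).Adj x y then
          star ψ ⬝ᵥ ((creation (orb x σ) * annihilation (orb y σ)) *ᵥ ψ) else 0).re ≤
        ∑ s, ‖ψ s‖ ^ 2 * (if (fermionTorusGraph 2 L).Adj x y then V α β s x y σ else 0) := by
    intro x y σ
    split_ifs with h
    · exact (Complex.re_le_norm _).trans (norm_bond_le hα hαβ ψ h.ne σ)
    · simp
  calc ∑ x : FermionTorus 2 L, ∑ y, ∑ σ : Fin 2,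
        (if (fermionTorusGraph 2 L).Adj x y then
          star ψ ⬝ᵥ ((creation (orb x σ) * annihilation (orb y σ)) *ᵥ ψ) else 0).re
      ≤ ∑ x : FermionTorus 2 L, ∑ y, ∑ σ : Fin 2,
          ∑ s, ‖ψ s‖ ^ 2 * (if (fermionTorusGraph 2 L).Adj x y then V α β s x y σ else 0) :=
        Finset.sum_le_sum fun x _ => Finset.sum_le_sum fun y _ => Finset.sum_le_sum fun σ _ =>
          hbond x y σ
    _ = ∑ s, ‖ψ s‖ ^ 2 * ∑ x : FermionTorus 2 L, ∑ y,
          (if (fermionTorusGraph 2 L).Adj x y then ∑ σ : Fin 2, V α β s x y σ else 0) := by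
        have e1 : ∀ (x y : FermionTorus 2 L),
            ∑ σ : Fin 2, ∑ s, ‖ψ s‖ ^ 2 *
                (if (fermionTorusGraph 2 L).Adj x y then V α β s x y σ else 0) =
              ∑ s, ∑ σ : Fin 2, ‖ψ s‖ ^ 2 *
                (if (fermionTorusGraph 2 L).Adj x y then V α β s x y σ else 0) :=
          fun x y => Finset.sum_comm
        have e2 : ∀ x : FermionTorus 2 L,
            ∑ y, ∑ s, ∑ σ : Fin 2, ‖ψ s‖ ^ 2 *
                (if (fermionTorusGraph 2 L).Adj x y then V α β s x y σ else 0) =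
              ∑ s, ∑ y, ∑ σ : Fin 2, ‖ψ s‖ ^ 2 *
                (if (fermionTorusGraph 2 L).Adj x y then V α β s x y σ else 0) :=
          fun x => Finset.sum_comm
        simp_rw [e1, e2]
        rw [Finset.sum_comm]
        refine Finset.sum_congr rfl fun s _ => ?_
        rw [Finset.mul_sum]
        refine Finset.sum_congr rfl fun x _ => ?_
        rw [Finset.mul_sum]
        refine Finset.sum_congr rfl fun y _ => ?_
        split_ifs
        · rw [Finset.mul_sum]
        · simp
    _ ≤ ∑ s, ‖ψ s‖ ^ 2 * (4 * (holeCount s : ℝ) + (4 + 16 * α) * (doublonCount s : ℝ) +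
          8 * β * (L : ℝ) ^ 2) :=
        Finset.sum_le_sum fun s _ =>
          mul_le_mul_of_nonneg_left (sum_adj_V_le hα.le hβ s) (by positivity)

/-- **The Mott floor** (Theorem 34, part 1). For `U ≥ 16` (`t = 1`) and every `N`-particle
vector `ψ` on the `L × L` torus,
`re ⟨ψ, H_U ψ⟩ ≥ -(4 (L² - N) + 64 L²/U) ‖ψ‖²`:
only the `L² - N` holes move freely; every other hop creates a doublon and is suppressed by `U`.
At density `1 - δ` this is `-(4δ + 64/U) L²` against the crude `-8N ≈ -8L²`. [this work] -/
theorem mott_floor {U : ℝ} (hU : 16 ≤ U) {N : ℕ} {ψ : Fock (Orb (FermionTorus 2 L))}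
    (hψ : IsNParticle N ψ) :
    -(4 * ((L : ℝ) ^ 2 - N) + 64 * (L : ℝ) ^ 2 / U) * (star ψ ⬝ᵥ ψ).re ≤
      (star ψ ⬝ᵥ hubbardTorus 2 L 1 U *ᵥ ψ).re := by
  have hU0 : 0 < U := by linarith
  set α : ℝ := U / 32 with hαdef
  set β : ℝ := 8 / U with hβdef
  have hα : 0 < α := by positivity
  have hαβ : 4 * α * β = 1 := by rw [hαdef, hβdef]; field_simp; ring
  -- split the Hamiltonian
  have hsplit : (star ψ ⬝ᵥ hubbardTorus 2 L 1 U *ᵥ ψ).re =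
      -(star ψ ⬝ᵥ (∑ x : FermionTorus 2 L, ∑ y, ∑ σ : Fin 2,
          if (fermionTorusGraph 2 L).Adj x y then creation (orb x σ) * annihilation (orb y σ)
          else 0) *ᵥ ψ).re +
        U * (star ψ ⬝ᵥ (∑ x : FermionTorus 2 L, numberOp x 0 * numberOp x 1) *ᵥ ψ).re := by
    simp only [hubbardTorus, hamiltonian, Complex.ofReal_one, neg_smul, one_smul, Matrix.add_mulVec,
      Matrix.neg_mulVec, Matrix.smul_mulVec, dotProduct_add, dotProduct_neg, dotProduct_smul,
      Complex.add_re, Complex.neg_re, smul_eq_mul, Complex.re_ofReal_mul]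
  rw [hsplit, re_expect_doublon, re_star_dotProduct_self_eq]
  have hhop := re_hopping_le hα hαβ ψ
  -- rewrite the hole count in the sector
  have hE := sum_holeCount_eq hψ
  have key : ∑ s, ‖ψ s‖ ^ 2 * (4 * (holeCount s : ℝ) + (4 + 16 * α) * (doublonCount s : ℝ) +
      8 * β * (L : ℝ) ^ 2) =
      ∑ s, ((4 * ((L : ℝ) ^ 2 - N) + 8 * β * (L : ℝ) ^ 2) * ‖ψ s‖ ^ 2 +
        (8 + 16 * α) * ((doublonCount s : ℝ) * ‖ψ s‖ ^ 2)) := by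
    have : ∑ s, ‖ψ s‖ ^ 2 * (4 * (holeCount s : ℝ) + (4 + 16 * α) * (doublonCount s : ℝ) +
        8 * β * (L : ℝ) ^ 2) =
        4 * ∑ s, (holeCount s : ℝ) * ‖ψ s‖ ^ 2 +
          ∑ s, ((4 + 16 * α) * ((doublonCount s : ℝ) * ‖ψ s‖ ^ 2) + 8 * β * (L : ℝ) ^ 2 * ‖ψ s‖ ^ 2) := by
      rw [Finset.mul_sum, ← Finset.sum_add_distrib]
      refine Finset.sum_congr rfl fun s _ => ?_; ring
    rw [this, hE, Finset.mul_sum, ← Finset.sum_add_distrib]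
    refine Finset.sum_congr rfl fun s _ => ?_; ring
  rw [key, Finset.sum_add_distrib, ← Finset.mul_sum, ← Finset.mul_sum] at hhop
  have h16 : 16 * α = U / 2 := by rw [hαdef]; ring
  have h8 : 8 * β * (L : ℝ) ^ 2 = 64 * (L : ℝ) ^ 2 / U := by rw [hβdef]; ring
  have hD0 : 0 ≤ ∑ s, (doublonCount s : ℝ) * ‖ψ s‖ ^ 2 :=
    Finset.sum_nonneg fun s _ => by positivity
  have hw0 : 0 ≤ ∑ s, ‖ψ s‖ ^ 2 := Finset.sum_nonneg fun s _ => by positivity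
  rw [h16, h8] at hhop
  nlinarith [hhop, hD0, hw0, mul_nonneg (by linarith : (0 : ℝ) ≤ U / 2 - 8) hD0]

/-- **The Mott floor of a sector**: `-(4 (L² - N) + 64 L²/U) ≤ minEnergyOn (H_U) (N, S_z = M)`
for `U ≥ 16` whenever the sector is non-trivial. [this work] -/
theorem mott_floor_minEnergyOn {U : ℝ} (hU : 16 ≤ U) {N : ℕ} {M : ℝ}
    (hK : szSector (Λ := FermionTorus 2 L) N M ≠ ⊥) :
    -(4 * ((L : ℝ) ^ 2 - N) + 64 * (L : ℝ) ^ 2 / U) ≤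
      (hubbardTorus 2 L 1 U).minEnergyOn (szSector (Λ := FermionTorus 2 L) N M) := by
  obtain ⟨φ, hφK, hφ1, hφE⟩ := exists_unit_eigen_minEnergyOn (isHermitian_hubbardTorus L 1 U) _
    (fun v hv =>
      _root_.Literature.MathematicalPhysics.QuantumLattice.hubbardTorus_mulVec_mem_szSector 1 U hv)
    hK
  rw [← _root_.Literature.MathematicalPhysics.QuantumLattice.re_rayleigh_of_eigen_minEnergyOn _ _
    hφ1 hφE]
  have h := mott_floor (L := L) hU ((mem_szSector_iff N M φ).1 hφK).1
  have h1 : (star φ ⬝ᵥ φ).re = 1 := by rw [hφ1]; simp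
  rw [h1, mul_one] at h
  exact h

end Summit.HubbardSuperconductivity.HubbardSuperconductivity.Theorems.MottFloor
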